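import Summits.AtomisticToContinuum.FouriersLaw.Theorems.PhononMeanFreePathCoherentDephasingStrictAbsorptionLandauerWitnessAux2

/-!
# Strict absorption, sub-goal K3 (3/3): the joint Landauer bound with the curvature witness
# (crux `PhononMeanFreePath.CoherentDephasing`, stmt-AtomisticToContinuum-11810; line `Sketch`, lead c2)

The registered sub-goal `sa_landauerWitness` of the lead's `N`-uniform strict-absorption theorem: for the `(N+1)`-site
pinned anharmonic chain with both baths at `T` (`N ≥ 2`), the local curvature at the kicked site
`Φ = U''(q₀) + V''(q₁ - q₀) = ω₂ + 3 lam q₀² + 1 + 3β(q₁-q₀)²`, `Φ̃ = Φ - ⟨Φ⟩`, and `u_s = K_s p₀`: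

  `∫_{s>0} { Var(Φ)·[⟨p₀,u_s⟩² + ⟨p_N,u_s⟩²] + ⟨p₀Φ̃, u_s⟩² } ds ≤ Var(Φ)·T²/(2γ)`

— the JOINT Landauer bound for the two bath responses to the kick with the slack of its Jensen step retained through
the which-path witness `⟨p₀Φ̃, u_s⟩ = T·Cov(∂_{p₀}u_s, Φ)` (`witness_lintegral_le` of `…LandauerWitnessAux2` with
`g = Φ̃`; `|Φ| ≤ C(1+H)`). No definition, no `sorry`, standard axioms.
-/

noncomputable section

open MeasureTheory ProbabilityTheory Filter Topology Set
open scoped NNReal ENNReal ContDiff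

namespace Summit.AtomisticToContinuum.FouriersLaw.Theorems.CoherentDephasing.StrictAbsorption

open Literature.MathematicalPhysics.KineticTheory.HeatConduction
open Literature.MathematicalPhysics.KineticTheory Literature.Probability.Process OscillatorChain
open Summit.AtomisticToContinuum.FouriersLaw.Theorems.IncoherentBounded
open Summit.AtomisticToContinuum.FouriersLaw.Theorems.SubdiffusiveBondHeat
open Summit.AtomisticToContinuum.FouriersLaw.Cruxes.SuperadditiveResistance.FloatingProbeBypassLaplacian

/-! ## The registered sub-goal: the witness is the centred local curvature `Φ̃ = Φ - ⟨Φ⟩` -/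

/-- **SUB-GOAL K3 of the strict-absorption theorem (registered stub `sa_landauerWitness`).** For the `(N+1)`-site
pinned anharmonic chain with both baths at `T` (`N ≥ 2`), the local curvature at the kicked site
`Φ = U''(q₀) + V''(q₁ - q₀) = ω₂ + 3 lam q₀² + 1 + 3β(q₁-q₀)²`, its Gibbs mean `⟨Φ⟩`, `Φ̃ = Φ - ⟨Φ⟩` and the forecast
`u_s = K_s p₀`:

  `∫_{s>0} { Var(Φ)·[⟨p₀,u_s⟩² + ⟨p_N,u_s⟩²] + ⟨p₀Φ̃, u_s⟩² } ds ≤ Var(Φ)·T²/(2γ)`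

— the JOINT Landauer bound for the two bath responses to the kick, with the slack of its Jensen step retained through
the which-path witness `⟨p₀Φ̃, u_s⟩ = T·Cov(∂_{p₀}u_s, Φ)` (`witness_lintegral_le` with `g = Φ̃`). [folklore] -/
theorem sa_landauerWitness :
    ∀ ω₂ lam β γ : ℝ, 0 < ω₂ → 0 < lam → 0 < β → 0 < γ → ∀ T : ℝ, 0 < T → ∀ (N : ℕ) (hN : 2 ≤ N), ∫⁻ s in Set.Ioi (0 : ℝ), ENNReal.ofReal ((∫ z, ((ω₂ + 3 * lam * z.1 0 ^ 2 + 1 + 3 * β * (z.1 ⟨1, by omega⟩ - z.1 0) ^ 2) - ∫ x, (ω₂ + 3 * lam * x.1 0 ^ 2 + 1 + 3 * β * (x.1 ⟨1, by omega⟩ - x.1 0) ^ 2) ∂((pinnedChain ω₂ lam β γ).gibbsMeasure (N + 1) T)) ^ 2 ∂((pinnedChain ω₂ lam β γ).gibbsMeasure (N + 1) T)) * ((∫ z, z.2 0 * (∫ y, y.2 0 ∂((pinnedChain ω₂ lam β γ).transitionKernel (N + 1) T T s.toNNReal z)) ∂((pinnedChain ω₂ lam β γ).gibbsMeasure (N +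 1) T)) ^ 2 + (∫ z, z.2 (Fin.last N) * (∫ y, y.2 0 ∂((pinnedChain ω₂ lam β γ).transitionKernel (N + 1) T T s.toNNReal z)) ∂((pinnedChain ω₂ lam β γ).gibbsMeasure (N + 1) T)) ^ 2) + (∫ z, (z.2 0 * ((ω₂ + 3 * lam * z.1 0 ^ 2 + 1 + 3 * β * (z.1 ⟨1, by omega⟩ - z.1 0) ^ 2) - ∫ x, (ω₂ + 3 * lam * x.1 0 ^ 2 + 1 + 3 * β * (x.1 ⟨1, by omega⟩ - x.1 0) ^ 2) ∂((pinnedChain ω₂ lam β γ).gibbsMeasure (N + 1) T))) * (∫ y, y.2 0 ∂((pinnedChain ω₂ lam β γ).transitionKernel (N + 1) T T s.toNNReal z)) ∂((pinnedChain ω₂ lam β γ).gibbsMeasure (N + 1) T)) ^ 2) ≤ ENNReal.ofReal ((∫ z, ((ω₂ + 3 * lam * z.1 0 ^ 2 + 1 + 3 * β * (z.1 ⟨1, by omega⟩ - z.1 0) ^ 2) - ∫ x, (ω₂ + 3 * lam * x.1 0 ^ 2 + 1 + 3 * β * (x.1 ⟨1, by omega⟩ - x.1 0) ^ 2) ∂((pinnedChain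 ω₂ lam β γ).gibbsMeasure (N + 1) T)) ^ 2 ∂((pinnedChain ω₂ lam β γ).gibbsMeasure (N + 1) T)) * (T ^ 2 / (2 * γ))) := by
  intro ω₂ lam β γ hω hl hβ hγ T hT N hN
  set P := pinnedChain ω₂ lam β γ with hP
  set μ := P.gibbsMeasure (N + 1) T with hμ
  haveI : IsProbabilityMeasure μ := pinnedChain_isProbabilityMeasure_gibbsMeasure hω hl.le hβ.le γ (N + 1) hT
  have h1 : 1 < N + 1 := by omega
  -- the curvature as a function of the positions, its size and its mean
  set Φq : (Fin (N + 1) → ℝ) → ℝ := fun q => ω₂ + 3 * lam * q 0 ^ 2 + 1 + 3 * β * (q ⟨1, by omega⟩ - q 0) ^ 2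
    with hΦq
  set Φbar : ℝ := ∫ x, Φq x.1 ∂μ with hΦbar
  set g : (Fin (N + 1) → ℝ) → ℝ := fun q => Φq q - Φbar with hg
  have hgd : ContDiff ℝ 1 g := by
    rw [hg, hΦq]
    fun_prop
  have hH0 : ∀ y, 0 ≤ P.hamiltonian (N + 1) y := fun y =>
    pinnedChain_hamiltonian_nonneg hω.le hl.le hβ.le γ (N + 1) y
  set CΦ : ℝ := (ω₂ + 1) + 6 * lam / ω₂ + 6 * β with hCΦ
  have hCΦ0 : 0 ≤ CΦ := by rw [hCΦ]; positivity
  have hΦb : ∀ z : PhaseSpace (N + 1), |Φq z.1| ≤ CΦ * (1 + P.hamiltonian (N + 1) z) := by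
    intro z
    set H := P.hamiltonian (N + 1) z with hH
    have hq0 : ω₂ * z.1 0 ^ 2 / 2 ≤ H := by
      have h := pinnedChain_harmonic_le_hamiltonian (ω₂ := ω₂) hl.le hβ.le γ (N + 1) z
      have h1' : ω₂ * z.1 0 ^ 2 / 2 ≤ ∑ i, ω₂ * z.1 i ^ 2 / 2 :=
        Finset.single_le_sum (f := fun i => ω₂ * z.1 i ^ 2 / 2) (fun i _ => by positivity) (Finset.mem_univ _)
      have h2' : 0 ≤ ∑ i, z.2 i ^ 2 / 2 := Finset.sum_nonneg fun i _ => by positivity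
      linarith
    have hb := (LightConeBondHeat.pinnedChain_bond_bounds hω.le hl.le hβ.le γ (N + 1) z
      (k := (0 : Fin (N + 1))) (l := ⟨1, h1⟩) (by simp)).1
    have hΦ0 : 0 ≤ Φq z.1 := by rw [hΦq]; dsimp only; positivity
    rw [abs_of_nonneg hΦ0, hΦq]; dsimp only
    have e1 : 3 * lam * z.1 0 ^ 2 ≤ 6 * lam / ω₂ * H := by
      rw [div_mul_eq_mul_div, le_div_iff₀ hω]
      nlinarith [mul_le_mul_of_nonneg_left hq0 (by positivity : (0:ℝ) ≤ 6 * lam)]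
    have e2 : 3 * β * (z.1 ⟨1, h1⟩ - z.1 0) ^ 2 ≤ 6 * β * H := by nlinarith [hβ.le]
    have hH0' : 0 ≤ H := hH0 z
    have : (6 * lam / ω₂) * H ≤ CΦ * H := by
      refine mul_le_mul_of_nonneg_right ?_ hH0'
      rw [hCΦ]; nlinarith [div_nonneg (by positivity : (0:ℝ) ≤ 6 * lam) hω.le]
    have : 6 * β * H ≤ CΦ * H := by
      refine mul_le_mul_of_nonneg_right ?_ hH0'
      rw [hCΦ]; nlinarith [div_nonneg (by positivity : (0:ℝ) ≤ 6 * lam) hω.le]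
    have : ω₂ + 1 ≤ CΦ := by rw [hCΦ]; nlinarith [div_nonneg (by positivity : (0:ℝ) ≤ 6 * lam) hω.le]
    nlinarith
  -- integrability of `Φ` and centring of `g`
  have hϑ0 : (0 : ℝ) < 1 / (2 * T) := by positivity
  have hϑ1 : 1 / (2 * T) < 1 / T := by rw [div_lt_div_iff₀ (by positivity) hT]; nlinarith
  have hexpμ := pinnedChain_integrable_exp_mul_hamiltonian_gibbsMeasure hω hl.le hβ.le γ (N + 1) hT hϑ1
  have hΦc : Continuous fun z : PhaseSpace (N + 1) => Φq z.1 := by rw [hΦq]; fun_prop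
  have hΦi : Integrable (fun z : PhaseSpace (N + 1) => Φq z.1) μ := by
    refine integrable_of_abs_le_exp hexpμ hΦc (C := CΦ * (2 * Real.exp (1 / (2 * T)) / (1 / (2 * T)) ^ 2))
      fun y => ?_
    calc |Φq y.1| ≤ CΦ * (1 + P.hamiltonian (N + 1) y) := hΦb y
      _ ≤ CΦ * (1 + P.hamiltonian (N + 1) y) ^ 2 :=
          mul_le_mul_of_nonneg_left (witness_one_add_le_sq hω hl.le hβ y) hCΦ0
      _ ≤ CΦ * ((2 * Real.exp (1 / (2 * T)) / (1 / (2 * T)) ^ 2) * Real.exp (1 / (2 * T) * P.hamiltonian (N + 1) y)) :=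
          mul_le_mul_of_nonneg_left (one_add_sq_le_exp (pinnedChain_hamiltonian_nonneg hω.le hl.le hβ.le γ _ y) hϑ0) hCΦ0
      _ = CΦ * (2 * Real.exp (1 / (2 * T)) / (1 / (2 * T)) ^ 2) * Real.exp (1 / (2 * T) * P.hamiltonian (N + 1) y) := by
          ring
  have hg0 : ∫ z, g z.1 ∂μ = 0 := by
    rw [hg]; dsimp only
    rw [integral_sub hΦi (integrable_const _), integral_const, probReal_univ, one_smul, hΦbar, sub_self]
  have hgb : ∀ z : PhaseSpace (N + 1), |g z.1| ≤ (CΦ + |Φbar|) * (1 + P.hamiltonian (N + 1) z) := by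
    intro z
    rw [hg]; dsimp only
    have h1' := hΦb z
    have h2' : |Φbar| ≤ |Φbar| * (1 + P.hamiltonian (N + 1) z) := by
      have := hH0 z; nlinarith [abs_nonneg Φbar]
    calc |Φq z.1 - Φbar| ≤ |Φq z.1| + |Φbar| := abs_sub _ _
      _ ≤ CΦ * (1 + P.hamiltonian (N + 1) z) + |Φbar| * (1 + P.hamiltonian (N + 1) z) := add_le_add h1' h2'
      _ = (CΦ + |Φbar|) * (1 + P.hamiltonian (N + 1) z) := by ring
  exact witness_lintegral_le hω hl.le hβ hγ hT (by omega) hgd hgb hg0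



end Summit.AtomisticToContinuum.FouriersLaw.Theorems.CoherentDephasing.StrictAbsorption

end
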